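import Mathlib
import Summits.ResolutionOfSingularities.ResolutionOfSingularities.Theorems.WildQuotientsWildQuotientResolutionFixedPointsRegular
import Summits.ResolutionOfSingularities.ResolutionOfSingularities.Theorems.WildQuotientsWildQuotientResolutionCyclicTransferConverse
import HarnessLib

/-!
# Regular invariant subalgebra ⟹ Király–Lütkebohmert terminal state, for `p ∈ {2, 3}`
# (converse of the chart adapter `isRegularRing_fixedPoints_zpowers`)

Route `ResolutionOfSingularities/WildQuotients`; helper toward the kill criterion of the crux
`CyclicQuotientFourfolds` (stmt-ResolutionOfSingularities-17941, research stub `stub_reachLowerInFX`,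
finding F10 «GOOD ⇒ PRINCIPAL»). The tree's `TameTransfer.isRegularRing_fixedPoints_zpowers` (crux
15640) is the `k`-algebra form of the cyclic transfer: terminal state ⇒ `U^⟨σ⟩` regular. This file
is its CONVERSE for `p ∈ {2, 3}` (and the resulting iff), by Király–Lütkebohmert's Conjecture 9 for
`p = 2, 3` (`CyclicTransfer.isRegularRing_eqLocus_iff_hdiv`): for a `k`-algebra automorphism
`σ ≠ 1`, `σ ^ p = 1`, of a regular domain `U` of finite type over `k`, if the invariant subalgebra
`FixedPoints.subalgebra k U (zpowers σ)` is a regular ring then at every `σ`-stable prime `𝔮` the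
augmentation ideal `(σ u − u : u)` becomes principal in `U_𝔮`. Module-finiteness of `U` over the
invariants is derived (finite type + integrality over the fixed ring, `CyclicTransfer.isIntegral_eqLocus`).

* `TameTransfer.moduleFinite_eqLocus_of_finiteType` — `U` is module-finite over `eqLocus σ id`.
* `TameTransfer.hdiv_of_isRegularRing_fixedPoints_zpowers` — the converse.
* `TameTransfer.isRegularRing_fixedPoints_zpowers_iff` — the iff for `p ∈ {2, 3}`.
  [cite: KiralyLutkebohmert2013, Thm. 2 and §3 Conjecture 9 (cases p = 2, 3)]

[OURS · crux stmt-ResolutionOfSingularities-17941 · helper (def-free); counted 0; AI-level work,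
weaker than expert review.]
-/

set_option linter.dupNamespace false

noncomputable section

namespace Summit.ResolutionOfSingularities.ResolutionOfSingularities.Theorems.WildQuotientResolution.TameTransfer

/-- A finite-type `k`-algebra `U` is module-finite over the fixed subring `eqLocus σ id` of a
`k`-algebra automorphism `σ` of finite order (`σ ^ p = 1`, `0 < p`): it is of finite type over the
fixed ring (same generators, `k ⊆ U^σ`) and integral over it. [folklore; E. Noether] -/
theorem moduleFinite_eqLocus_of_finiteType {k U : Type} [Field k] [CommRing U] [Algebra k U]
    [Algebra.FiniteType k U] {p : ℕ} (hp : 0 < p) (σ : U ≃ₐ[k] U) (hσp : σ ^ p = 1) :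
    Module.Finite (((σ : U ≃+* U) : U →+* U).eqLocus (RingHom.id U)) U := by
  classical
  set τ : U ≃+* U := (σ : U ≃+* U) with hτ
  set A : Subring U := (τ : U →+* U).eqLocus (RingHom.id U) with hA
  have hτ_pow : ∀ (n : ℕ) (u : U), (τ ^ n) u = (σ ^ n) u := by
    intro n
    induction n with
    | zero => intro u; rfl
    | succ n ih =>
      intro u
      rw [pow_succ, pow_succ, RingAut.mul_apply, AlgEquiv.mul_apply, ih]
      rfl
  have hτp : τ ^ p = RingEquiv.refl U := by
    ext u
    rw [hτ_pow, hσp, AlgEquiv.one_apply, RingEquiv.refl_apply]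
  haveI : Algebra.IsIntegral A U := CyclicTransfer.isIntegral_eqLocus hp τ hτp
  -- finite type over the fixed ring: the `k`-generators generate
  haveI : Algebra.FiniteType A U := by
    obtain ⟨s, hs⟩ := (inferInstance : Algebra.FiniteType k U).out
    refine ⟨⟨s, ?_⟩⟩
    rw [eq_top_iff]
    rintro u -
    have hu : u ∈ Algebra.adjoin k (s : Set U) := by rw [hs]; exact Algebra.mem_top
    induction hu using Algebra.adjoin_induction with
    | mem x hx => exact Algebra.subset_adjoin hx
    | algebraMap c =>
      have hc : algebraMap k U c ∈ A := by
        show τ (algebraMap k U c) = algebraMap k U c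
        exact σ.commutes c
      exact Subalgebra.algebraMap_mem (Algebra.adjoin A (s : Set U)) (⟨algebraMap k U c, hc⟩ : A)
    | add x y _ _ hx hy => exact Subalgebra.add_mem _ hx hy
    | mul x y _ _ hx hy => exact Subalgebra.mul_mem _ hx hy
  exact Algebra.IsIntegral.finite

/-- **Regular invariant subalgebra ⟹ terminal state (`p ∈ {2, 3}`)**: for a `k`-algebra
automorphism `σ ≠ 1`, `σ ^ p = 1` with `p ∈ {2, 3}`, of a regular domain `U` of finite type over
`k`, if `FixedPoints.subalgebra k U (zpowers σ)` is a regular ring then at every `σ`-stable prime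
`𝔮` of `U` the augmentation ideal `(σ u − u : u ∈ U)` becomes principal in `U_𝔮`.
[cite: KiralyLutkebohmert2013, §3 Conjecture 9 (cases p = 2, 3)] -/
theorem hdiv_of_isRegularRing_fixedPoints_zpowers {k U : Type} [Field k] [CommRing U] [IsDomain U]
    [IsRegularRing U] [Algebra k U] [Algebra.FiniteType k U] {p : ℕ} (hp : p.Prime)
    (hp23 : p = 2 ∨ p = 3) (σ : U ≃ₐ[k] U) (hσ1 : σ ≠ 1) (hσp : σ ^ p = 1)
    [IsRegularRing (FixedPoints.subalgebra k U (Subgroup.zpowers σ))]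
    (𝔮 : Ideal U) [𝔮.IsPrime] (h𝔮 : 𝔮.comap σ = 𝔮) :
    ((Ideal.span (Set.range fun u : U => σ u - u)).map
      (algebraMap U (Localization.AtPrime 𝔮))).IsPrincipal := by
  classical
  set τ : U ≃+* U := (σ : U ≃+* U) with hτ
  have hτ_apply : ∀ u : U, τ u = σ u := fun u => rfl
  have hτ_pow : ∀ (n : ℕ) (u : U), (τ ^ n) u = (σ ^ n) u := by
    intro n
    induction n with
    | zero => intro u; rfl
    | succ n ih =>
      intro u
      rw [pow_succ, pow_succ, RingAut.mul_apply, AlgEquiv.mul_apply, hτ_apply, ih]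
  have hτ1 : τ ≠ RingEquiv.refl U := by
    intro h
    apply hσ1
    ext u
    have := hτ_apply u
    rw [h, RingEquiv.refl_apply] at this
    exact this.symm
  have hτp : τ ^ p = RingEquiv.refl U := by
    ext u
    rw [hτ_pow, hσp, AlgEquiv.one_apply, RingEquiv.refl_apply]
  -- the tautological isomorphism with `eqLocus τ id`
  let e : FixedPoints.subalgebra k U (Subgroup.zpowers σ) ≃+* (τ : U →+* U).eqLocus (RingHom.id U) :=
    { toFun := fun x => ⟨x.1, (mem_fixedPoints_zpowers_iff σ x.1).mp x.2⟩
      invFun := fun x => ⟨x.1, (mem_fixedPoints_zpowers_iff σ x.1).mpr x.2⟩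
      left_inv := fun _ => rfl
      right_inv := fun _ => rfl
      map_mul' := fun _ _ => rfl
      map_add' := fun _ _ => rfl }
  haveI : IsRegularRing ((τ : U →+* U).eqLocus (RingHom.id U)) := IsRegularRing.of_ringEquiv e
  haveI : Module.Finite ((τ : U →+* U).eqLocus (RingHom.id U)) U :=
    moduleFinite_eqLocus_of_finiteType hp.pos σ hσp
  have h𝔮' : 𝔮.comap τ = 𝔮 := by
    refine Eq.trans ?_ h𝔮
    ext u
    rw [Ideal.mem_comap, Ideal.mem_comap, hτ_apply]
  exact (CyclicTransfer.isRegularRing_eqLocus_iff_hdiv hp hp23 τ hτ1 hτp).mp inferInstance 𝔮 h𝔮'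

/-- **The chart adapter is an iff for `p ∈ {2, 3}`**: `U^⟨σ⟩` is a regular ring iff the
Király–Lütkebohmert terminal state holds at every `σ`-stable prime.
[cite: KiralyLutkebohmert2013, Thm. 2 and §3 Conjecture 9 (cases p = 2, 3)] -/
theorem isRegularRing_fixedPoints_zpowers_iff {k U : Type} [Field k] [CommRing U] [IsDomain U]
    [IsRegularRing U] [Algebra k U] [Algebra.FiniteType k U] {p : ℕ} (hp : p.Prime)
    (hp23 : p = 2 ∨ p = 3) (σ : U ≃ₐ[k] U) (hσ1 : σ ≠ 1) (hσp : σ ^ p = 1) :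
    IsRegularRing (FixedPoints.subalgebra k U (Subgroup.zpowers σ)) ↔
      ∀ (𝔮 : Ideal U) [𝔮.IsPrime], 𝔮.comap σ = 𝔮 →
        ((Ideal.span (Set.range fun u : U => σ u - u)).map
          (algebraMap U (Localization.AtPrime 𝔮))).IsPrincipal :=
  ⟨fun h 𝔮 _ h𝔮 => by
      haveI := h
      exact hdiv_of_isRegularRing_fixedPoints_zpowers hp hp23 σ hσ1 hσp 𝔮 h𝔮,
    fun h => isRegularRing_fixedPoints_zpowers hp σ hσ1 hσp h⟩

end Summit.ResolutionOfSingularities.ResolutionOfSingularities.Theorems.WildQuotientResolution.TameTransfer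

end
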